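import Summits.ABC.IUTFork.Joshi.ATS4Reading3DiscOddPart
import Summits.ABC.IUTFork.Joshi.ATS4Lem671AtDivisionField
import Literature.NumberTheory.GaloisRepresentations.SplitsCompletelyCriteria
import Mathlib.NumberTheory.NumberField.Cyclotomic.Ideal
import HarnessLib

/-!
# [J-IV] (arXiv:2403.10430v2) Lemma 6.7.1 (2) ⟺ (3) IN FULL at Joshi's `L′ = F(E_F[ℓ])`: the `30ℓ`-clause of rows Y-21c/e/f
# DISCHARGED from the rows' own binder `hKℓ`, p460339's reading-(3) hypothesis `hVdst` PROVED at the genuine tower, and print's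
# sentence «`K ∋ ζ_{4·3·5·l}`, hence ramified over `ℚ` at ANY valuation dividing `2·3·5·l`» ([IUTchIV] p.25 l.5–7) in kernel

Proof-only companion (0 defs) of the abc-iut cell, R-J «Joshi Y-discharge census» rows **Y-21c / Y-21e / Y-21f**, clause (i)
(rung LADDER-ABC:A2.RESCUE.J), seat abc-iut-E-t24 (gen 10; authors-first rider on the seat's own
`Joshi/ATS4RowsCEFReading3Genuine.lean`, p465152, which stays byte-identical — DEFS-FREEZE). SOURCES: K. Joshi, *Construction of
Arithmetic Teichmüller Spaces IV*, arXiv:2403.10430v2 (unrefereed; bib `Joshi2024ATS4`), §6.6 p.60 l.56–62, Lemma 6.6.1 + proof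
p.60 l.63–p.61 l.12 («… by the properties of the Weil pairings [Silverman, 1985] one sees that `L′ ⊃ ℚ(ζ_{60·ℓ})`. If `v_M` extends
to some prime `v` of `L′` which is ramified then `v ∣ d_M` or `v ∣ q_M` or `v ∣ 2·3·5·ℓ`»), Lemma 6.7.1 p.61 l.20–30; S. Mochizuki,
*IUT IV*, proof of Thm. 1.10 Step (v), p.25 l.2–7 («… it follows … that `K` contains a primitive `4·3·5·l`-th root of unity, hence
is ramified over `ℚ` at any valuation `∈ 𝕍(K)^non` that divides `2·3·5·l`»). Page/line = the cell's renders `HOME/lit/renders/`.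

WHAT WAS OPEN. p465152 isolated, at a tower reading `V^dst_ℚ` by the §6.6 DEFINITION at `L′ = K` and modulo the rider (P2), ONE
named clause of p460339's reading-(3) hypothesis `hVdst`: `h30 : ∀ p ∈ primeFactors(30ℓ), p ∈ primeFactors(disc K)`
(`TowerGlue.vdst_eq_reading3_iff_thirtyL_of_condP2`, `rows_cef_thetaTower_genuine_of_condP2`). Overnight the ingredients landed:
abc-iut-E-cx-3's `ATS4Reading3DiscTwoPart` (p471065: `2 ∣ disc K` over a theta field; `ζ_p ∈ K ⟹ p ∣ disc K`) and
`ATS4Reading3DiscOddPart` (p486541: the Weil pairing IS in the tree — `3·5 ∣ disc K` over a theta field; `ℓ ∣ disc K` whenever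
`ψ(K) ⊇ F(E_F[ℓ])`), and abc-iut-E-t35's `ATS4Lem671AtDivisionField` (the binder `hKℓ` supplied at `ψ.fieldRange = F(E_F[ℓ])`).
p486541's HONEST SCOPE notes that its `ℓ`-part does NOT apply to a `K` carrying only the cell's `hK` («`ψ(K) ⊆ F(E_F[ℓ])`»). But the
rows' theorems in p465152 carry, besides `hK`, the binder `hKℓ : ∀ σ : Γ_K, ∀ Q ∈ E_K[ℓ](K̄), σ • Q = Q` («`K ⊇ L′`», E-t35 p462498)
— and THAT binder gives `μ_ℓ ⊂ K` directly, by the tree's Weil pairing over `K` for the base-changed Legendre curve `E_K` (§1). So: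

* §1 `GenuineVdst.thirtyL_clause_of_geomTorsion_rational` — **`h30` PROVED** at (`λ ∈ U`, `F` a theta field, `K ⊇ F`, `hKℓ`, `ℓ` an
  odd prime): the `2·3·5`-part by p471065/p486541 BY NAME, the `ℓ`-part from `hKℓ`.
* §2 print's STRONGER sentence ([IUTchIV] p.25 l.6–7): a primitive `p^{k+1}`-th root of unity in `K` (`p^{k+1} ≠ 2`) makes EVERY
  place of `K` over `p` ramified over `ℚ` (`e ≥ p^k(p−1) ≥ 2`: Mathlib `IsCyclotomicExtension.Rat.ramificationIdx_eq_of_prime_pow`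
  on `ℚ(ζ) ⊆ K`, going-up `two_le_ramificationIdx_of_finBelow` p460339); at the data of §1 **every place of `K` whose residue
  characteristic divides `2·3·5·ℓ` has `e ≥ 2`** (`two_le_ramificationIdx_of_residueChar_dvd_thirtyL`) — the form Lemma 6.6.1
  (2) ⟹ (1) uses at an intermediate `M` («`v_M` extends to a prime of `L′` ramified over `ℚ`»: ANY prime of `L′` over `v_M` is).
* §3 **Lemma 6.7.1 (2) ⟺ (3) IN FULL** — `primeFactors(disc K) = primeFactors(30ℓ) ∪ p(Supp 𝔮_{F_tpd}) ∪ primeFactors(disc F_tpd)`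
  — at (`hK`, `hKℓ`, `K/F` Galois, `ℓ ≥ 7` prime, (P2)) and at Joshi's ACTUAL `L′` (`ψ.fieldRange = (thetaCurve P F).divisionField ℓ`,
  all else supplied by E-t35 §1): E-t35 g8's `primeFactors_discr_sdiff_eq_reading3_sdiff_of_fieldRange_eq_divisionField` WITHOUT
  the `\ primeFactors(30ℓ)`; modulo (P2) ONLY, itself read off `ITDConditions` (`…_of_itdConditions`); non-vacuity over every
  admissible `(λ, ℓ)` (§5, E-t35's `exists_thetaField_divisionField_lem671` upgraded to the full equation).
* §4 **p460339's `hVdst` DISCHARGED** under E-t31's `TowerGlue` to a tower reading `V^dst_ℚ` by the §6.6 definition at `L′`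
  (`TowerGlue.vdst_eq_reading3_of_genuine_of_condP2`, `…_of_fieldRange_eq_divisionField`), and **rows c/e/f — `dd.Eq6111 ∧
  dd.ComponentSums ∧ dd.Eq6811` — at the genuine tower with NO named clause left but (P2)** (`rows_cef_thetaTower_genuine_of_condP2'`,
  `rows_cef_thetaTower_divisionField_of_condP2`): p465152's corollary with `h30` gone.

FRAMING (binding): classical algebraic number theory (cyclotomic ramification, Dedekind's discriminant theorem, the Weil pairing —
all PROVED in the tree / Mathlib) composed with the cell's PROVED statements. NO side is taken on [IUTchIII] Cor. 3.12 / [IUTchIV]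
Thm. 1.10, on Joshi's claims or on Mochizuki's report on them; NOT a test verdict; NOT an abc claim. Typed ≠ proved ≠ endorsed.
Theorems only; standard axioms; no `sorry`, instance, notation, `def` or new `Prop`. FACT rows: none. [claim: Joshi2024ATS4,
status: disputed].
-/

noncomputable section

open Finset NumberField IsDedekindDomain
open Literature.IUT.LogVolume Literature.IUT.LogVolume.Cor22
open Literature.NumberTheory.DiophantineGeometry Literature.NumberTheory.DiophantineGeometry.GenEll
open Literature.NumberTheory.EllipticCurves
open Literature.NumberTheory.GaloisRepresentations (liesOver_span_of_natCast_mem_asIdeal)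

namespace Summit.ABC.IUTFork.Joshi.ATS4

universe u

namespace GenuineVdst

/-! ## 1. The `ℓ`-part of clause (i) from the rows' binder `hKℓ`; `h30` PROVED -/

section TorsionRational

variable {P : NFPoint} {F : Type} [Field F] [NumberField F] [Algebra P.F F]
  {K : Type} [Field K] [NumberField K] [Algebra F K] [Algebra P.F K]

/-- **`E_K[n] ⊂ E_K(K)` forces `μ_n ⊂ K`** for the Legendre curve `E_K = thetaCurve λ K` of `λ ∈ U` over any number field
`K ⊇ F_tpd` and any prime `n`: the rows' binder `hKℓ` («`Γ_K` fixes `E_K[n](K̄)` pointwise», E-t35 p462498) fed to the tree's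
Weil pairing over `K` (abc-iut-E-cx-3's `exists_isPrimitiveRoot_of_torsion_fixed`, p486541, on Silverman *AEC* III.8.1 /
Cor. 8.1.1 PROVED in `Literature/NumberTheory/EllipticCurves/WeilPairingProofs.lean`). [cite: SilvermanAEC2009, Cor. III.8.1.1] -/
theorem exists_isPrimitiveRoot_of_geomTorsion_rational (hU : P.InU) {n : ℕ} (hn : n.Prime)
    (hKn : ∀ (σ : Field.absoluteGaloisGroup K) (Q : WeierstrassCurve.geomTorsion (thetaCurve P K) (n : ℤ)), σ • Q = Q) :
    ∃ ζ : K, IsPrimitiveRoot ζ n := by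
  haveI := thetaCurve_isElliptic hU K
  refine exists_isPrimitiveRoot_of_torsion_fixed (E := thetaCurve P K) hn fun σ T hT => ?_
  have hmem : T ∈ WeierstrassCurve.geomTorsion (thetaCurve P K) (n : ℤ) := by
    simpa only [AddSubgroup.torsionBy, Submodule.mem_toAddSubgroup, Submodule.mem_torsionBy_iff] using hT
  exact (AddSubgroup.torsionBy.coe_smul σ ⟨T, hmem⟩).symm.trans (congrArg Subtype.val (hKn σ ⟨T, hmem⟩))

/-- **`hKℓ` ⟹ `ℓ ∈ primeFactors |disc K|`** (`ℓ` an odd prime): `μ_ℓ ⊂ K` (`exists_isPrimitiveRoot_of_geomTorsion_rational`) and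
`disc ℚ(ζ_ℓ) ∣ disc K` (p471065 `mem_primeFactors_discr_of_isPrimitiveRoot`). The `ℓ`-part of [J-IV] Lemma 6.7.1 (3) ⟹ (2) at the
primes of `30ℓ` for the `K ⊇ L′` of the rows — the direction p486541's `hK`-only scope note leaves out.
[claim: Joshi2024ATS4, status: disputed] -/
theorem mem_primeFactors_discr_of_geomTorsion_rational (hU : P.InU) {ℓ : ℕ} (hℓ : ℓ.Prime) (hℓ2 : ℓ ≠ 2)
    (hKℓ : ∀ (σ : Field.absoluteGaloisGroup K) (Q : WeierstrassCurve.geomTorsion (thetaCurve P K) (ℓ : ℤ)), σ • Q = Q) :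
    ℓ ∈ (discr K).natAbs.primeFactors := by
  obtain ⟨ζ, hζ⟩ := exists_isPrimitiveRoot_of_geomTorsion_rational hU hℓ hKℓ
  exact mem_primeFactors_discr_of_isPrimitiveRoot hℓ hℓ2 hζ

/-- A prime divisor of `2·3·5·ℓ` is `2`, `3`, `5` or `ℓ` (`ℓ` prime). [folklore] -/
theorem eq_or_eq_of_prime_dvd_thirtyL {ℓ p : ℕ} (hℓ : ℓ.Prime) (hp : p.Prime) (hdvd : p ∣ 2 * 3 * 5 * ℓ) :
    p = 2 ∨ p = 3 ∨ p = 5 ∨ p = ℓ := by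
  rcases (Nat.Prime.dvd_mul hp).mp hdvd with h30 | hl
  · rcases (Nat.Prime.dvd_mul hp).mp h30 with h6 | h5
    · rcases (Nat.Prime.dvd_mul hp).mp h6 with h2 | h3
      · exact Or.inl ((Nat.prime_dvd_prime_iff_eq hp Nat.prime_two).mp h2)
      · exact Or.inr (Or.inl ((Nat.prime_dvd_prime_iff_eq hp Nat.prime_three).mp h3))
    · exact Or.inr (Or.inr (Or.inl ((Nat.prime_dvd_prime_iff_eq hp Nat.prime_five).mp h5)))
  · exact Or.inr (Or.inr (Or.inr ((Nat.prime_dvd_prime_iff_eq hp hℓ).mp hl)))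

/-- **`h30` OF p465152 PROVED — clause (i) of rows Y-21c/e/f at the rows' own data.** For `λ ∈ U`, `F` a theta field of `λ`
([IUTchIV] Cor. 2.2: `√−1 ∈ F`, `E_F[15] ⊂ E_F(F)`), a number field `K ⊇ F` with `hKℓ` («`Γ_K` fixes `E_K[ℓ](K̄)`», i.e.
`K ⊇ L′ = F(E_F[ℓ])`) and `ℓ` an odd prime: **every prime dividing `2·3·5·ℓ` divides `disc K`**. The `2·3·5`-part is
abc-iut-E-cx-3's `primeFactors_discr_supset_of_isThetaField_algebra` (p486541; `2` from `√−1`, p471065; `3, 5` from `E_F[15] ⊂ E_F(F)`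
and the Weil pairing), the `ℓ`-part is `mem_primeFactors_discr_of_geomTorsion_rational`. Print: [IUTchIV] p.25 l.5–6 «`K` contains a
primitive `4·3·5·l`-th root of unity»; [J-IV] Lemma 6.6.1, proof, p.61 l.10–11 «`L′ ⊃ ℚ(ζ_{60·ℓ})`». PROVED; FACT rows none.
[claim: Joshi2024ATS4, status: disputed] -/
theorem thirtyL_clause_of_geomTorsion_rational (hU : P.InU) (hF : IsThetaField P F) {ℓ : ℕ} (hℓ : ℓ.Prime) (hℓ2 : ℓ ≠ 2)
    (hKℓ : ∀ (σ : Field.absoluteGaloisGroup K) (Q : WeierstrassCurve.geomTorsion (thetaCurve P K) (ℓ : ℤ)), σ • Q = Q) :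
    ∀ p ∈ (2 * 3 * 5 * ℓ).primeFactors, p ∈ (discr K).natAbs.primeFactors := by
  intro p hp
  obtain ⟨hpr, hdvd, -⟩ := Nat.mem_primeFactors.mp hp
  have h235 := primeFactors_discr_supset_of_isThetaField_algebra hF hU K
  rcases eq_or_eq_of_prime_dvd_thirtyL hℓ hpr hdvd with rfl | rfl | rfl | rfl <;>
    first | exact mem_primeFactors_discr_of_geomTorsion_rational hU hℓ hℓ2 hKℓ | exact h235 (by simp)

end TorsionRational

/-! ## 2. Print's stronger sentence: a root of unity ramifies EVERY place over its primes ([IUTchIV] p.25 l.6–7) -/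

/-- For a natural number `p` and number fields `K₀ ⊆ K`: `p ∈ u ∩ 𝓞_{K₀}` iff `p ∈ u`. [folklore] -/
theorem natCast_mem_finBelow_asIdeal_iff {K₀ : Type*} {K : Type*} [Field K₀] [NumberField K₀] [Field K] [NumberField K]
    [Algebra K₀ K] (u : HeightOneSpectrum (𝓞 K)) (p : ℕ) :
    ((p : ℕ) : 𝓞 K₀) ∈ (finBelow K₀ K u).asIdeal ↔ ((p : ℕ) : 𝓞 K) ∈ u.asIdeal := by
  change ((p : ℕ) : 𝓞 K₀) ∈ Ideal.comap (algebraMap (𝓞 K₀) (𝓞 K)) u.asIdeal ↔ _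
  rw [Ideal.mem_comap, map_natCast]

/-- `2 ≤ p^k · (p − 1)` for a prime `p` unless `p^{k+1} = 2`. [folklore] -/
theorem two_le_pow_mul_pred {p k : ℕ} (hp : p.Prime) (h2 : p ^ (k + 1) ≠ 2) : 2 ≤ p ^ k * (p - 1) := by
  rcases Nat.lt_or_ge p 3 with hlt | hge
  · have hp2 : p = 2 := by have := hp.two_le; omega
    subst hp2
    have hk : k ≠ 0 := by
      rintro rfl
      exact h2 (by norm_num)
    calc 2 = 2 ^ 1 * (2 - 1) := by norm_num
      _ ≤ 2 ^ k * (2 - 1) := Nat.mul_le_mul_right _ (Nat.pow_le_pow_right (by norm_num) (Nat.one_le_iff_ne_zero.mpr hk))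
  · calc 2 = 1 * 2 := by norm_num
      _ ≤ p ^ k * (p - 1) := Nat.mul_le_mul (Nat.one_le_pow _ _ hp.pos) (by omega)

/-- **A primitive `p^{k+1}`-th root of unity in a number field `K`, `p^{k+1} ≠ 2`, makes EVERY place of `K` over `p` ramified
over `ℚ`**: with `K₀ = ℚ(ζ) ⊆ K` and `w = u ∩ 𝓞_{K₀}`, `e(w|p) = p^k(p−1)` (`p` is totally ramified in `ℚ(ζ_{p^{k+1}})`, Mathlib
`IsCyclotomicExtension.Rat.ramificationIdx_eq_of_prime_pow`) and `e(u|p) = e(w|p)·e(u|w) ≥ 2` (going-up, p460339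
`two_le_ramificationIdx_of_finBelow`). [IUTchIV] p.25 l.6–7 «hence is ramified over `ℚ` at any valuation … that divides
`2·3·5·l`». [cite: Washington1997, Lemma 1.4] -/
theorem two_le_ramificationIdx_of_isPrimitiveRoot_prime_pow {K : Type u} [Field K] [NumberField K] {p k : ℕ}
    (hp : p.Prime) (h2 : p ^ (k + 1) ≠ 2) {ζ : K} (hζ : IsPrimitiveRoot ζ (p ^ (k + 1)))
    (u : HeightOneSpectrum (𝓞 K)) (hu : ((p : ℕ) : 𝓞 K) ∈ u.asIdeal) :
    2 ≤ u.asIdeal.ramificationIdx ℤ := by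
  haveI : Fact p.Prime := ⟨hp⟩
  haveI : NeZero (p ^ (k + 1) : ℕ) := ⟨pow_ne_zero _ hp.ne_zero⟩
  let K₀ : Type u := ↥(IntermediateField.adjoin ℚ ({ζ} : Set K))
  haveI : IsCyclotomicExtension {p ^ (k + 1)} ℚ K₀ :=
    IsPrimitiveRoot.intermediateField_adjoin_isCyclotomicExtension (K := ℚ) hζ
  have hwp : ((p : ℕ) : 𝓞 K₀) ∈ (finBelow K₀ K u).asIdeal := (natCast_mem_finBelow_asIdeal_iff u p).2 hu
  haveI := liesOver_span_of_natCast_mem_asIdeal hp (finBelow K₀ K u) hwp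
  have hram : (finBelow K₀ K u).asIdeal.ramificationIdx ℤ = p ^ k * (p - 1) :=
    IsCyclotomicExtension.Rat.ramificationIdx_eq_of_prime_pow p k K₀ (finBelow K₀ K u).asIdeal
  exact two_le_ramificationIdx_of_finBelow (F := K₀) u (hram ▸ two_le_pow_mul_pred hp h2)

/-- **A primitive `p`-th root of unity (`p` an odd prime) ramifies every place over `p`** (`e ≥ p − 1 ≥ 2`). [cite: Washington1997, Lemma 1.4] -/
theorem two_le_ramificationIdx_of_isPrimitiveRoot {K : Type u} [Field K] [NumberField K] {p : ℕ} (hp : p.Prime) (hp2 : p ≠ 2)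
    {ζ : K} (hζ : IsPrimitiveRoot ζ p) (u : HeightOneSpectrum (𝓞 K)) (hu : ((p : ℕ) : 𝓞 K) ∈ u.asIdeal) :
    2 ≤ u.asIdeal.ramificationIdx ℤ :=
  two_le_ramificationIdx_of_isPrimitiveRoot_prime_pow (k := 0) hp (by rwa [zero_add, pow_one])
    (by rwa [zero_add, pow_one]) u hu

/-- **`√−1 ∈ K` ramifies every place over `2`** (`ℚ(i) ⊆ K`, `e(𝔭|2) = 2` in `ℚ(i) = ℚ(ζ_4)`). [cite: Washington1997, Lemma 1.4] -/
theorem two_le_ramificationIdx_of_sq_eq_neg_one {K : Type u} [Field K] [NumberField K] {i : K} (hi : i ^ 2 = -1)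
    (u : HeightOneSpectrum (𝓞 K)) (hu : ((2 : ℕ) : 𝓞 K) ∈ u.asIdeal) : 2 ≤ u.asIdeal.ramificationIdx ℤ :=
  two_le_ramificationIdx_of_isPrimitiveRoot_prime_pow (p := 2) (k := 1) Nat.prime_two (by norm_num)
    (by rw [show (2 : ℕ) ^ (1 + 1) = 4 by norm_num]; exact isPrimitiveRoot_four_of_sq_eq_neg_one hi) u hu

section TorsionRational

variable {P : NFPoint} {F : Type} [Field F] [NumberField F] [Algebra P.F F]
  {K : Type} [Field K] [NumberField K] [Algebra F K] [Algebra P.F K]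

omit [NumberField K] [Algebra P.F K] in
/-- A theta field's `K ⊇ F` contains a primitive `p`-th root of unity for `p ∈ {3, 5}` (`E_F[15] ⊂ E_F(F)` and the Weil pairing,
p486541 `exists_isPrimitiveRoot_of_torsion_fixed` / `torsion_fixed_of_isThetaField`, transported along `F ⊆ K`).
[claim: Mochizuki2012, status: disputed] -/
theorem exists_isPrimitiveRoot_of_isThetaField_of_dvd_fifteen (hU : P.InU) (hF : IsThetaField P F) {p : ℕ} (hp : p.Prime)
    (hp15 : p ∣ 15) : ∃ ζ : K, IsPrimitiveRoot ζ p := by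
  haveI := thetaCurve_isElliptic hU F
  obtain ⟨ζ, hζ⟩ := exists_isPrimitiveRoot_of_torsion_fixed (E := thetaCurve P F) hp (torsion_fixed_of_isThetaField hF hp15)
  exact ⟨algebraMap F K ζ, hζ.map_of_injective (algebraMap F K).injective⟩

/-- **Print's sentence at the rows' data — EVERY place of `K` over a prime of `2·3·5·ℓ` is ramified over `ℚ`.** For `λ ∈ U`, `F` a
theta field, `K ⊇ F` with `hKℓ` («`K ⊇ L′`») and `ℓ` prime: a place `u` of `K` whose residue characteristic divides `2·3·5·ℓ` has
`e(u | p_u) ≥ 2` (`√−1 ∈ F`; `μ_3, μ_5 ⊂ F`; `μ_ℓ ⊂ K`; each root of unity ramifies every place over its prime, §2). This is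
[IUTchIV] p.25 l.6–7 verbatim and the form [J-IV] Lemma 6.6.1 (2) ⟹ (1) needs at an intermediate `L_mod ⊆ M ⊆ L′` («`v_M ∣ 30ℓ`
⟹ `v_M` extends to a prime of `L′` ramified over `ℚ`»: ANY prime of `L′` over `v_M` is). STRONGER than `h30` (`∃` a ramified place
over each `p ∣ 30ℓ`). PROVED. [claim: Joshi2024ATS4, status: disputed] -/
theorem two_le_ramificationIdx_of_residueChar_dvd_thirtyL (hU : P.InU) (hF : IsThetaField P F) {ℓ : ℕ} (hℓ : ℓ.Prime)
    (hKℓ : ∀ (σ : Field.absoluteGaloisGroup K) (Q : WeierstrassCurve.geomTorsion (thetaCurve P K) (ℓ : ℤ)), σ • Q = Q)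
    (u : HeightOneSpectrum (𝓞 K)) (hu : residueChar K u ∣ 2 * 3 * 5 * ℓ) : 2 ≤ u.asIdeal.ramificationIdx ℤ := by
  have hpu : ((residueChar K u : ℕ) : 𝓞 K) ∈ u.asIdeal := natCast_residueChar_mem K u
  -- the `p = 2` branch, used twice (`p_u = 2`, or `p_u = ℓ = 2`)
  have htwo : residueChar K u = 2 → 2 ≤ u.asIdeal.ramificationIdx ℤ := fun h2 => by
    obtain ⟨i, hi⟩ := hF.sqrt_neg_one
    have hi' : (algebraMap F K i) ^ 2 = -1 := by rw [← map_pow, hi, map_neg, map_one]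
    exact two_le_ramificationIdx_of_sq_eq_neg_one hi' u (h2 ▸ hpu)
  rcases eq_or_eq_of_prime_dvd_thirtyL hℓ (residueChar_prime K u) hu with h | h | h | h
  · exact htwo h
  · obtain ⟨ζ, hζ⟩ := exists_isPrimitiveRoot_of_isThetaField_of_dvd_fifteen (K := K) hU hF Nat.prime_three ⟨5, by norm_num⟩
    exact two_le_ramificationIdx_of_isPrimitiveRoot Nat.prime_three (by norm_num) hζ u (h ▸ hpu)
  · obtain ⟨ζ, hζ⟩ := exists_isPrimitiveRoot_of_isThetaField_of_dvd_fifteen (K := K) hU hF Nat.prime_five ⟨3, by norm_num⟩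
    exact two_le_ramificationIdx_of_isPrimitiveRoot Nat.prime_five (by norm_num) hζ u (h ▸ hpu)
  · by_cases hℓ2 : ℓ = 2
    · exact htwo (h.trans hℓ2)
    · obtain ⟨ζ, hζ⟩ := exists_isPrimitiveRoot_of_geomTorsion_rational hU hℓ hKℓ
      exact two_le_ramificationIdx_of_isPrimitiveRoot hℓ hℓ2 hζ u (h ▸ hpu)

end TorsionRational

end GenuineVdst

/-! ## 3. Lemma 6.7.1 (2) ⟺ (3) IN FULL at `L′`, modulo (P2) only -/

section ThetaTower

variable {P : NFPoint} {F : Type} [Field F] [NumberField F] [Algebra P.F F]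
  {K : Type} [Field K] [NumberField K] [Algebra F K] [Algebra P.F K] [IsScalarTower P.F F K]
  (ψ : K →ₐ[F] AlgebraicClosure F) {ℓ : ℕ}

/-- **[J-IV] Lemma 6.7.1 (2) ⟺ (3) IN FULL — `primeFactors(disc K) = primeFactors(30ℓ) ∪ p(Supp 𝔮_{F_tpd}) ∪ primeFactors(disc F_tpd)`
as finite sets of rational primes** — for `λ ∈ U`, `F` a theta field, `K` Galois over `F` with `hK` («`K ⊆ L′`») and `hKℓ` («`K ⊇ L′`»),
`ℓ ≥ 7` prime, modulo the located rider (P2) ONLY. `⊆` is E-t35's (2) ⟹ (3) (p456387); `⊇` is clause (i) (§1, PROVED here) ∧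
E-t35's (4) ⟹ (2) (p462498/p462897) ∧ `disc F_tpd ∣ disc K`. E-t35 g8 had the same equation OFF `primeFactors(30ℓ)`
(`primeFactors_discr_sdiff_eq_reading3_sdiff`); the `sdiff` is now gone. PROVED. [claim: Joshi2024ATS4, status: disputed] -/
theorem GenuineVdst.primeFactors_discr_eq_reading3_of_condP2 (hU : P.InU) (hF : IsThetaField P F) [IsGalois F K]
    (hℓ : ℓ.Prime) (h7 : 7 ≤ ℓ) (hP2 : CondP2 P ℓ)
    (hK : letI := thetaCurve_isElliptic hU F
      ((thetaCurve P F).galoisRepTorsion (ℓ : ℤ)).ker ≤ ψ.fieldRange.fixingSubgroup)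
    (hKℓ : ∀ (σ : Field.absoluteGaloisGroup K) (Q : WeierstrassCurve.geomTorsion (thetaCurve P K) (ℓ : ℤ)), σ • Q = Q) :
    (discr K).natAbs.primeFactors = (2 * 3 * 5 * ℓ).primeFactors ∪
        (TateDivisorDatum.ofNFPoint P {2, ℓ}).V.image (residueChar P.F) ∪ (discr P.F).natAbs.primeFactors :=
  (GenuineVdst.primeFactors_discr_eq_reading3_iff ψ hU hF hℓ hK).2
    ((GenuineVdst.reading3_subset_primeFactors_discr_iff P ℓ K).2
      ⟨GenuineVdst.thirtyL_clause_of_geomTorsion_rational hU hF hℓ (by omega) hKℓ, fun v hv =>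
        GenuineVdst.image_residueChar_ofNFPoint_subset_primeFactors_discr hU hF hℓ h7 hP2 hKℓ (S := {2, ℓ}) (by simp)
          (Finset.mem_image_of_mem _ hv)⟩)

/-- **Lemma 6.7.1 (2) ⟺ (3) IN FULL at Joshi's ACTUAL `L′ = F(E_F[ℓ])`** (any abstract copy: `ψ.fieldRange = (thetaCurve P F).divisionField ℓ`;
`λ ∈ U`, `F` a theta field, `ℓ ≥ 7` prime), MODULO (P2) ONLY: `K/F` Galois, `hK` and `hKℓ` are all read off the one equation
(E-t35 g8 §1: `isGalois_of_fieldRange_eq_divisionField`, `ker_le_and_le_ker_of_fieldRange_eq_divisionField`,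
`forall_smul_geomTorsion_eq_of_fieldRange_fixingSubgroup_le`). PROVED. [claim: Joshi2024ATS4, status: disputed] -/
theorem GenuineVdst.primeFactors_discr_eq_reading3_of_fieldRange_eq_divisionField (hU : P.InU) (hF : IsThetaField P F)
    (hℓ : ℓ.Prime) (h7 : 7 ≤ ℓ) (hP2 : CondP2 P ℓ) (hψ : ψ.fieldRange = (thetaCurve P F).divisionField ℓ) :
    (discr K).natAbs.primeFactors = (2 * 3 * 5 * ℓ).primeFactors ∪
        (TateDivisorDatum.ofNFPoint P {2, ℓ}).V.image (residueChar P.F) ∪ (discr P.F).natAbs.primeFactors := by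
  haveI : NeZero ℓ := ⟨hℓ.ne_zero⟩
  haveI : IsGalois F K := GenuineVdst.isGalois_of_fieldRange_eq_divisionField ψ hU hψ
  obtain ⟨hK, hK'⟩ := GenuineVdst.ker_le_and_le_ker_of_fieldRange_eq_divisionField ψ hU hψ
  exact GenuineVdst.primeFactors_discr_eq_reading3_of_condP2 ψ hU hF hℓ h7 hP2 hK
    (GenuineVdst.forall_smul_geomTorsion_eq_of_fieldRange_fixingSubgroup_le ψ hK')

/-- **At «Initial Theta Data with the prime `ℓ`»** (`ITDConditions λ ℓ` = `7 ≤ ℓ ∧ (P2) ∧ (P5) ∧ (P6)`, E-t33's reading of Thm. 5.7.1's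
conclusion, under whose assumptions Lemma 6.7.1 is stated): the full equation at `L′` with the rider and `ℓ ≥ 7` read off the
standing data — no separate binders. PROVED. [claim: Joshi2024ATS4, status: disputed] -/
theorem GenuineVdst.primeFactors_discr_eq_reading3_of_itdConditions (hU : P.InU) (hF : IsThetaField P F) (hℓ : ℓ.Prime)
    (hitd : ITDConditions P ℓ) (hψ : ψ.fieldRange = (thetaCurve P F).divisionField ℓ) :
    (discr K).natAbs.primeFactors = (2 * 3 * 5 * ℓ).primeFactors ∪
        (TateDivisorDatum.ofNFPoint P {2, ℓ}).V.image (residueChar P.F) ∪ (discr P.F).natAbs.primeFactors :=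
  GenuineVdst.primeFactors_discr_eq_reading3_of_fieldRange_eq_divisionField ψ hU hF hℓ hitd.1 hitd.2.1 hψ

/-! ## 4. p460339's `hVdst` DISCHARGED at the genuine tower; rows c/e/f with no named clause but (P2) -/

/-- **p460339's reading-(3) hypothesis `hVdst` HOLDS** for every carrier `dd` under E-t31's `TowerGlue T dd` to a tower `T` reading
`V^dst_ℚ` by the §6.6 DEFINITION at `L′ = K` (`hT`), at (`λ ∈ U`, `F` theta field, `K/F` Galois, `hK`, `hKℓ`, `ℓ ≥ 7` prime, (P2)):
`dd.Vdst = primeFactors(30ℓ) ∪ p(Supp 𝔮_{F_tpd}) ∪ primeFactors(disc F_tpd)`. p465152's biconditional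
`vdst_eq_reading3_iff_thirtyL_of_condP2` with its right-hand side PROVED (§1). [claim: Joshi2024ATS4, status: disputed] -/
theorem PrimeTowerDatum.TowerGlue.vdst_eq_reading3_of_genuine_of_condP2 (hU : P.InU) (hF : IsThetaField P F) [IsGalois F K]
    (hℓ : ℓ.Prime) (h7 : 7 ≤ ℓ) (hP2 : CondP2 P ℓ)
    (hK : letI := thetaCurve_isElliptic hU F
      ((thetaCurve P F).galoisRepTorsion (ℓ : ℤ)).ker ≤ ψ.fieldRange.fixingSubgroup)
    (hKℓ : ∀ (σ : Field.absoluteGaloisGroup K) (Q : WeierstrassCurve.geomTorsion (thetaCurve P K) (ℓ : ℤ)), σ • Q = Q)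
    {T : PrimeTowerDatum} {dd : LocusVolumeDatum} (GT : PrimeTowerDatum.TowerGlue T dd)
    (hT : ∀ p, p ∈ T.VdstQ ↔ ∃ u : HeightOneSpectrum (𝓞 K), residueChar K u = p ∧ 2 ≤ u.asIdeal.ramificationIdx ℤ) :
    dd.Vdst = (2 * 3 * 5 * ℓ).primeFactors ∪ (TateDivisorDatum.ofNFPoint P {2, ℓ}).V.image (residueChar P.F) ∪
        (discr P.F).natAbs.primeFactors :=
  (GT.vdst_eq_reading3_iff_thirtyL_of_condP2 ψ hU hF hℓ h7 hP2 hK hKℓ hT).2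
    (GenuineVdst.thirtyL_clause_of_geomTorsion_rational hU hF hℓ (by omega) hKℓ)

/-- **`hVdst` at Joshi's ACTUAL `L′`** (`ψ.fieldRange = (thetaCurve P F).divisionField ℓ`): the reading-(3) equation holds for every
carrier under `TowerGlue` to a tower reading `V^dst_ℚ` genuinely at `L′`, modulo (P2) only. PROVED. [claim: Joshi2024ATS4, status: disputed] -/
theorem PrimeTowerDatum.TowerGlue.vdst_eq_reading3_of_fieldRange_eq_divisionField (hU : P.InU) (hF : IsThetaField P F)
    (hℓ : ℓ.Prime) (h7 : 7 ≤ ℓ) (hP2 : CondP2 P ℓ) (hψ : ψ.fieldRange = (thetaCurve P F).divisionField ℓ)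
    {T : PrimeTowerDatum} {dd : LocusVolumeDatum} (GT : PrimeTowerDatum.TowerGlue T dd)
    (hT : ∀ p, p ∈ T.VdstQ ↔ ∃ u : HeightOneSpectrum (𝓞 K), residueChar K u = p ∧ 2 ≤ u.asIdeal.ramificationIdx ℤ) :
    dd.Vdst = (2 * 3 * 5 * ℓ).primeFactors ∪ (TateDivisorDatum.ofNFPoint P {2, ℓ}).V.image (residueChar P.F) ∪
        (discr P.F).natAbs.primeFactors := by
  rw [GT.vdst_eq_primeFactors_discr K hT]
  exact GenuineVdst.primeFactors_discr_eq_reading3_of_fieldRange_eq_divisionField ψ hU hF hℓ h7 hP2 hψ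

/-- **ROWS c, e, f AT THE GENUINE TOWER, modulo (P2), NO `h30`.** p465152's `rows_cef_thetaTower_genuine_of_condP2` with its one
named clause `h30` («the primes of `2·3·5·ℓ` divide `disc K`») DISCHARGED by §1: for `λ ∈ U_X`, `F` a theta field, `K/F` Galois with
`hK`/`hKℓ` (`K = L′`), `ℓ ≥ 7` prime with (P2), a carrier `dd` `MainBoundGlue`d to the genuine datum, `DescentGlue`d, and
`TowerGlue`d to a tower reading `V^dst_ℚ` by the §6.6 definition at `L′`, with the genuine component readings (per-`p` hull bundle,
arch `0`, different / `q` fibre sums): `dd.Eq6111 ∧ dd.ComponentSums ∧ dd.Eq6811`. PROVED AS AN IMPLICATION from the glues and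
readings; NO clause of Lemma 6.7.1 remains a hypothesis. [claim: Joshi2024ATS4, status: disputed] -/
theorem LocusVolumeDatum.rows_cef_thetaTower_genuine_of_condP2' (hP : P ∈ UP) (hF : IsThetaField P F) [IsGalois F K]
    (hℓ : ℓ.Prime) (h7 : 7 ≤ ℓ) (hP2 : CondP2 P ℓ)
    (hK : letI := thetaCurve_isElliptic hP.1 F
      ((thetaCurve P F).galoisRepTorsion (ℓ : ℤ)).ker ≤ ψ.fieldRange.fixingSubgroup)
    (hKℓ : ∀ (σ : Field.absoluteGaloisGroup K) (Q : WeierstrassCurve.geomTorsion (thetaCurve P K) (ℓ : ℤ)), σ • Q = Q)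
    (Lmod : Type*) [Field Lmod] [NumberField Lmod] (h5 : 5 ≤ ℓ)
    (hq : 0 < (TateDivisorDatum.ofNFPointOver P {2, ℓ} F).logq)
    {dd : LocusVolumeDatum}
    (G : MainBoundGlue (MainBoundDatum.ofGenuine Lmod hℓ h5 (TateDivisorDatum.ofNFPoint P {2, ℓ})
      (TateDivisorDatum.ofNFPointOver P {2, ℓ} F) (TateDivisorDatum.ofNFPointOver P {2, ℓ} K) hq) dd)
    (hmod : Cor22.dmod P ≤ dMod Lmod)
    {lstar : ℕ} {W : Type} [Fintype W] {D : SecondMainBoundDatum lstar W} (GD : DescentGlue D dd)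
    {T : PrimeTowerDatum} (GT : PrimeTowerDatum.TowerGlue T dd)
    (hT : ∀ p, p ∈ T.VdstQ ↔ ∃ u : HeightOneSpectrum (𝓞 K), residueChar K u = p ∧ 2 ≤ u.asIdeal.ramificationIdx ℤ)
    (ι : W → HeightOneSpectrum (𝓞 F)) (hι : ∀ w, ι w ∈ (TateDivisorDatum.ofNFPointOver P {2, ℓ} F).V)
    (hAt : ∀ p ∈ dd.Vdst, dd.logVolAt p = ∑ w ∈ Finset.univ with residueChar F (ι w) = p, |Real.log (D.std.loc w).hullVol|)
    (hArch : dd.logVolArch = 0)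
    (DK : Finset (HeightOneSpectrum (𝓞 K))) (hDK : ∀ u, differentDivisor K (Sum.inr u) ≠ 0 → u ∈ DK)
    (hDiffAt : ∀ p ∈ dd.Vdst, dd.logDiffLpAt p =
      (Module.finrank ℚ K : ℝ)⁻¹ * ∑ u ∈ DK with residueChar K u = p, differentDivisor K (Sum.inr u) * logNorm K u)
    (hqAt : ∀ p ∈ dd.Vdst, dd.logqAt p =
      (Module.finrank ℚ F : ℝ)⁻¹ * ∑ w ∈ (TateDivisorDatum.ofNFPointOver P {2, ℓ} F).V with residueChar F w = p,
        (TateDivisorDatum.ofNFPointOver P {2, ℓ} F).tateDivisor (Sum.inr w) * logNorm F w) :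
    dd.Eq6111 ∧ dd.ComponentSums ∧ dd.Eq6811 :=
  LocusVolumeDatum.rows_cef_thetaTower_genuine_of_condP2 ψ hP hF hℓ h7 hP2 hK hKℓ Lmod h5 hq G hmod GD GT hT
    (GenuineVdst.thirtyL_clause_of_geomTorsion_rational hP.1 hF hℓ (by omega) hKℓ) ι hι hAt hArch DK hDK hDiffAt hqAt

/-- **ROWS c, e, f at Joshi's ACTUAL `L′`** (`ψ.fieldRange = (thetaCurve P F).divisionField ℓ`): as `rows_cef_thetaTower_genuine_of_condP2'`
with `K/F` Galois, `hK` and `hKℓ` read off the one equation (E-t35 g8 §1). Modulo (P2) only. PROVED AS AN IMPLICATION from the glues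
and readings. [claim: Joshi2024ATS4, status: disputed] -/
theorem LocusVolumeDatum.rows_cef_thetaTower_divisionField_of_condP2 (hP : P ∈ UP) (hF : IsThetaField P F)
    (hℓ : ℓ.Prime) (h7 : 7 ≤ ℓ) (hP2 : CondP2 P ℓ) (hψ : ψ.fieldRange = (thetaCurve P F).divisionField ℓ)
    (Lmod : Type*) [Field Lmod] [NumberField Lmod] (h5 : 5 ≤ ℓ)
    (hq : 0 < (TateDivisorDatum.ofNFPointOver P {2, ℓ} F).logq)
    {dd : LocusVolumeDatum}
    (G : MainBoundGlue (MainBoundDatum.ofGenuine Lmod hℓ h5 (TateDivisorDatum.ofNFPoint P {2, ℓ})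
      (TateDivisorDatum.ofNFPointOver P {2, ℓ} F) (TateDivisorDatum.ofNFPointOver P {2, ℓ} K) hq) dd)
    (hmod : Cor22.dmod P ≤ dMod Lmod)
    {lstar : ℕ} {W : Type} [Fintype W] {D : SecondMainBoundDatum lstar W} (GD : DescentGlue D dd)
    {T : PrimeTowerDatum} (GT : PrimeTowerDatum.TowerGlue T dd)
    (hT : ∀ p, p ∈ T.VdstQ ↔ ∃ u : HeightOneSpectrum (𝓞 K), residueChar K u = p ∧ 2 ≤ u.asIdeal.ramificationIdx ℤ)
    (ι : W → HeightOneSpectrum (𝓞 F)) (hι : ∀ w, ι w ∈ (TateDivisorDatum.ofNFPointOver P {2, ℓ} F).V)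
    (hAt : ∀ p ∈ dd.Vdst, dd.logVolAt p = ∑ w ∈ Finset.univ with residueChar F (ι w) = p, |Real.log (D.std.loc w).hullVol|)
    (hArch : dd.logVolArch = 0)
    (DK : Finset (HeightOneSpectrum (𝓞 K))) (hDK : ∀ u, differentDivisor K (Sum.inr u) ≠ 0 → u ∈ DK)
    (hDiffAt : ∀ p ∈ dd.Vdst, dd.logDiffLpAt p =
      (Module.finrank ℚ K : ℝ)⁻¹ * ∑ u ∈ DK with residueChar K u = p, differentDivisor K (Sum.inr u) * logNorm K u)
    (hqAt : ∀ p ∈ dd.Vdst, dd.logqAt p =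
      (Module.finrank ℚ F : ℝ)⁻¹ * ∑ w ∈ (TateDivisorDatum.ofNFPointOver P {2, ℓ} F).V with residueChar F w = p,
        (TateDivisorDatum.ofNFPointOver P {2, ℓ} F).tateDivisor (Sum.inr w) * logNorm F w) :
    dd.Eq6111 ∧ dd.ComponentSums ∧ dd.Eq6811 := by
  haveI : NeZero ℓ := ⟨hℓ.ne_zero⟩
  haveI : IsGalois F K := GenuineVdst.isGalois_of_fieldRange_eq_divisionField ψ hP.1 hψ
  obtain ⟨hK, hK'⟩ := GenuineVdst.ker_le_and_le_ker_of_fieldRange_eq_divisionField ψ hP.1 hψ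
  exact LocusVolumeDatum.rows_cef_thetaTower_genuine_of_condP2' ψ hP hF hℓ h7 hP2 hK
    (GenuineVdst.forall_smul_geomTorsion_eq_of_fieldRange_fixingSubgroup_le ψ hK') Lmod h5 hq G hmod GD GT hT ι hι hAt hArch
    DK hDK hDiffAt hqAt

end ThetaTower

/-! ## 5. NON-VACUITY: the full equation's hypothesis set is INHABITED over every admissible `(λ, ℓ)` -/

namespace GenuineVdst

/-- **For EVERY `λ ∈ U_X` and EVERY prime `ℓ ≥ 7` with (P2): a theta field `F` and `K = L′ = F(E_F[ℓ])` (Galois over `F`,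
`ψ(K) = F(E_F[ℓ])`, `hKℓ`) EXIST at which Lemma 6.7.1 (2) ⟺ (3) holds IN FULL for Joshi's `S = {2, ℓ}`** — E-t35 g8's
`exists_thetaField_divisionField_lem671` with its last conjunct upgraded from «off `30ℓ`» to the full equation (theta field: the
tree's `Cor22.exists_isThetaField`, [IUTchIV] Prop. 1.8 (v)/(vi); `L′`: `WeierstrassCurve.divisionField`). So §3–§4 are not vacuously
true. PROVED. [claim: Joshi2024ATS4, status: disputed] -/
theorem exists_thetaField_divisionField_lem671_full (P : NFPoint) (hU : P.InU) {ℓ : ℕ} (hℓ : ℓ.Prime) (h7 : 7 ≤ ℓ)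
    (hP2 : CondP2 P ℓ) :
    ∃ (F : Type) (_ : Field F) (_ : NumberField F) (_ : Algebra P.F F) (K : Type) (_ : Field K) (_ : NumberField K)
      (_ : Algebra F K) (_ : Algebra P.F K) (_ : IsScalarTower P.F F K) (_ : IsGalois F K) (ψ : K →ₐ[F] AlgebraicClosure F),
      IsThetaField P F ∧ ψ.fieldRange = (thetaCurve P F).divisionField ℓ ∧
      (∀ (σ : Field.absoluteGaloisGroup K) (Q : WeierstrassCurve.geomTorsion (thetaCurve P K) (ℓ : ℤ)), σ • Q = Q) ∧
      (discr K).natAbs.primeFactors = (2 * 3 * 5 * ℓ).primeFactors ∪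
        (TateDivisorDatum.ofNFPoint P {2, ℓ}).V.image (residueChar P.F) ∪ (discr P.F).natAbs.primeFactors := by
  obtain ⟨F, _, _, _, K, _, _, _, _, _, _, ψ, hF, hψ, hKℓ, -, -⟩ := exists_thetaField_divisionField_lem671 P hU hℓ h7 hP2
  exact ⟨F, inferInstance, inferInstance, inferInstance, K, inferInstance, inferInstance, inferInstance, inferInstance,
    inferInstance, inferInstance, ψ, hF, hψ, hKℓ,
    primeFactors_discr_eq_reading3_of_fieldRange_eq_divisionField ψ hU hF hℓ h7 hP2 hψ⟩

end GenuineVdst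

end Summit.ABC.IUTFork.Joshi.ATS4

end
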